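import Summits.Ventures.PercRepro.C025ProfilePLDTwoFlat
import Summits.Ventures.PercRepro.C025ProfilePavingPLD

/-!
# PER-LAYER DOMINANCE FOR THE FREE AND THE UNIFORM MATROIDS (night-3 g30)

`proofs/NIGHT3-G30-PAREXT.md` §7.  The free matroid on a finset has no circuit, so g28's `PavingPLD.pld_of_paving`
applies vacuously (`pld_freeOn`); the uniform matroid `U_{s,F}` is its truncation (`pld_uniform`, by
`PLDTruncate.pld_truncate`).  Two ready-made generators for the closure system.  No `def`, no `instance`, no notation.
Axioms: standard.
-/

open scoped Matroid

namespace PercRepro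

open Finset ThmH

namespace PLDTruncate

variable {α : Type} [DecidableEq α]

/-- PER-LAYER DOMINANCE FOR THE FREE MATROID on a finset (no circuits: paving vacuously). -/
theorem pld_freeOn (F : Finset α) :
    haveI := freeOn_finite' F
    ∀ lo hi δ Θ : ℕ, Θ ≤ lo + hi + δ → (lo = 0 ∨ lo + hi + δ ≤ Θ) →
      (∑ I ∈ (gr (Matroid.freeOn (F : Set α))).powerset,
        (if lo ≤ ((Matroid.freeOn (F : Set α)).eRk (I : Set α)).toNat ∧
            ((Matroid.freeOn (F : Set α)).eRk (I : Set α)).toNat ≤ hi ∧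
            Θ ≤ ((Matroid.freeOn (F : Set α)).eRk ((gr (Matroid.freeOn (F : Set α)) \ I : Finset α) : Set α)).toNat +
              ((Matroid.freeOn (F : Set α)).eRk (I : Set α)).toNat then
          (((Matroid.freeOn (F : Set α)).eRk ((gr (Matroid.freeOn (F : Set α)) \ I : Finset α) : Set α)).toNat).choose δ
        else 0)) ≤
      ∑ I ∈ (gr (Matroid.freeOn (F : Set α))).powerset,
        (if lo + δ ≤ ((Matroid.freeOn (F : Set α)).eRk ((gr (Matroid.freeOn (F : Set α)) \ I : Finset α) : Set α)).toNat ∧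
            ((Matroid.freeOn (F : Set α)).eRk ((gr (Matroid.freeOn (F : Set α)) \ I : Finset α) : Set α)).toNat ≤ hi + δ then
          (((Matroid.freeOn (F : Set α)).eRk ((gr (Matroid.freeOn (F : Set α)) \ I : Finset α) : Set α)).toNat).choose δ
        else 0) := by
  haveI := freeOn_finite' F
  exact PavingPLD.pld_of_paving _ fun C hC =>
    absurd (Matroid.freeOn_indep_iff.2 hC.subset_ground) hC.not_indep

/-- PER-LAYER DOMINANCE FOR THE UNIFORM MATROID `U_{s,F} = truncate (freeOn F) s`. -/
theorem pld_uniform (F : Finset α) (s : ℕ) :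
    haveI := freeOn_finite' F
    ∀ lo hi δ Θ : ℕ, Θ ≤ lo + hi + δ → (lo = 0 ∨ lo + hi + δ ≤ Θ) →
      (∑ I ∈ (gr (Matroid.truncate (Matroid.freeOn (F : Set α)) s)).powerset,
        (if lo ≤ ((Matroid.truncate (Matroid.freeOn (F : Set α)) s).eRk (I : Set α)).toNat ∧
            ((Matroid.truncate (Matroid.freeOn (F : Set α)) s).eRk (I : Set α)).toNat ≤ hi ∧
            Θ ≤ ((Matroid.truncate (Matroid.freeOn (F : Set α)) s).eRk
              ((gr (Matroid.truncate (Matroid.freeOn (F : Set α)) s) \ I : Finset α) : Set α)).toNat +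
              ((Matroid.truncate (Matroid.freeOn (F : Set α)) s).eRk (I : Set α)).toNat then
          (((Matroid.truncate (Matroid.freeOn (F : Set α)) s).eRk
            ((gr (Matroid.truncate (Matroid.freeOn (F : Set α)) s) \ I : Finset α) : Set α)).toNat).choose δ
        else 0)) ≤
      ∑ I ∈ (gr (Matroid.truncate (Matroid.freeOn (F : Set α)) s)).powerset,
        (if lo + δ ≤ ((Matroid.truncate (Matroid.freeOn (F : Set α)) s).eRk
              ((gr (Matroid.truncate (Matroid.freeOn (F : Set α)) s) \ I : Finset α) : Set α)).toNat ∧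
            ((Matroid.truncate (Matroid.freeOn (F : Set α)) s).eRk
              ((gr (Matroid.truncate (Matroid.freeOn (F : Set α)) s) \ I : Finset α) : Set α)).toNat ≤ hi + δ then
          (((Matroid.truncate (Matroid.freeOn (F : Set α)) s).eRk
            ((gr (Matroid.truncate (Matroid.freeOn (F : Set α)) s) \ I : Finset α) : Set α)).toNat).choose δ
        else 0) := by
  haveI := freeOn_finite' F
  exact pld_truncate _ (pld_freeOn F) s

end PLDTruncate

end PercRepro
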